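import Literature.Geometry.Lorentzian.BrokenGeodesicVertex
import Literature.Geometry.Lorentzian.CausalLimitCurveLength
import Literature.Geometry.Lorentzian.ReverseTriangleInequality
import Literature.Geometry.Lorentzian.CausalLimitSequence
import Mathlib.Topology.Order.IsLUB
import HarnessLib

/-!
# Maximal causal geodesics from a compact set (O'Neill 1983, Ch. 14, Prop. 14.19 and Thm. 14.44)

Let `(M, g, τ)` be a strongly causal time-oriented Lorentzian manifold (smooth metric), `A` a
compact set, `q` a point, and suppose every future causal curve from a point of `A` to `q` lies in
a fixed compact set `K` (as is the case for `A = S ∩ J⁻(q)` and `K = J⁺(S) ∩ J⁻(q)` when `S` is a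
Cauchy hypersurface of a globally hyperbolic spacetime, O'Neill 1983, Ch. 14, Lemma 14.40). If
some point of `A` is at positive time separation from `q`, then **there is a timelike geodesic
from a point `p₀ ∈ A` to `q` whose length bounds the time separation `τ(p, q)` of every `p ∈ A`**
(`LorentzianMetric.exists_maximal_geodesic_of_isCompact`) — the maximal geodesic from `A` to `q`
of O'Neill's Thm. 14.44 (first half) / Prop. 14.19, proved without the continuity of the time
separation: a maximising sequence of causal curves has a finite limit chain of maximal radial
geodesic segments whose lengths add up to at least the supremum
(`exists_limit_chain_arcLength_le`, O'Neill's Lemma 14.14), the reverse triangle inequality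
(`lorentzDist_add_lorentzDist_le`) turns every inequality along the chain into an equality, the
vertex analysis `vertex_of_maximal` (O'Neill's Prop. 10.46) shows that all segments are timelike
with matching unit tangents at the vertices, and the flow property of geodesics concatenates
them into one geodesic (`maximalGeodesic_of_matching_chain`).

Everything is proved; no definitions and no named facts are introduced (D-0026).

## References

* B. O'Neill, *Semi-Riemannian geometry with applications to relativity*, Academic Press 1983,
  Ch. 14, Lemma 14.14, Prop. 14.19, Lemma 14.40, Thm. 14.44 (pp. 408–427); Ch. 10, Prop. 10.46.
  [ONeillSemiRiemannian1983]
-/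

noncomputable section

open Bundle Set Filter Function Topology Metric
open scoped Manifold ContDiff ENNReal

namespace Literature.Geometry.Lorentzian

open Literature.Geometry.Riemannian

/-- Termwise equality from an inequality of finite sums in `ℝ≥0∞` the other way round, when the
smaller sum is finite. [folklore] -/
lemma ENNReal.eq_of_sum_le_of_le {ι : Type*} {s : Finset ι} {f h : ι → ℝ≥0∞}
    (hle : ∀ i ∈ s, h i ≤ f i) (hsum : ∑ i ∈ s, f i ≤ ∑ i ∈ s, h i)
    (hfin : ∑ i ∈ s, h i ≠ ⊤) : ∀ i ∈ s, f i = h i := by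
  classical
  intro j hj
  by_contra hne
  have hlt : h j < f j := lt_of_le_of_ne (hle j hj) (Ne.symm hne)
  have hR : ∑ i ∈ s.erase j, h i ≠ ⊤ :=
    ne_top_of_le_ne_top hfin (Finset.sum_le_sum_of_subset (Finset.erase_subset j s))
  have h1 : ∑ i ∈ s, h i = h j + ∑ i ∈ s.erase j, h i := (Finset.add_sum_erase s h hj).symm
  have h2 : ∑ i ∈ s, f i = f j + ∑ i ∈ s.erase j, f i := (Finset.add_sum_erase s f hj).symm
  have h3 : ∑ i ∈ s.erase j, h i ≤ ∑ i ∈ s.erase j, f i :=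
    Finset.sum_le_sum fun i hi ↦ hle i (Finset.mem_of_mem_erase hi)
  have h4 : h j + ∑ i ∈ s.erase j, h i < f j + ∑ i ∈ s.erase j, f i :=
    calc h j + ∑ i ∈ s.erase j, h i < f j + ∑ i ∈ s.erase j, h i :=
          ENNReal.add_lt_add_right hR hlt
      _ ≤ f j + ∑ i ∈ s.erase j, f i := add_le_add le_rfl h3
  rw [← h1, ← h2] at h4
  exact absurd hsum (not_le.2 h4)

variable {E : Type*} [NormedAddCommGroup E] [NormedSpace ℝ E] {H : Type*} [TopologicalSpace H]
  {I : ModelWithCorners ℝ E H} {M : Type*} [TopologicalSpace M] [ChartedSpace H M]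
  [IsManifold I ∞ M] [FiniteDimensional ℝ E] [CompleteSpace E] [T2Space M]
  [BoundarylessManifold I M]

/-! ### Concatenation of geodesic segments with matching unit tangents -/

section Concat

variable {cov : CovariantDerivative I E (TangentSpace I : M → Type _)}
  [CovariantDerivative.ContMDiffCovariantDerivative cov 1]

/-- **Concatenation of radial geodesic segments with matching tangents.** Let
`σᵢ : r ↦ exp_{vᵢ}(r aᵢ)`, `r ∈ [0, 1]`, `i < k`, be geodesic segments with `σᵢ(1) = vᵢ₊₁` and
positive "lengths" `ℓᵢ`, such that at each interior vertex the rescaled tangents agree,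
`σᵢ'(1)/ℓᵢ = aᵢ₊₁/ℓᵢ₊₁`. Then the maximal geodesic `Γ` with initial data `(v₀, a₀/ℓ₀)` is
defined on `[0, ∑ ℓᵢ]` and passes through the vertices: `Γ(ℓ₀ + ⋯ + ℓᵢ₋₁) = vᵢ` (flow property
`maximalGeodesic_translate` and rescaling `maximalGeodesic_smul_of_mem`). [folklore] -/
theorem maximalGeodesic_of_matching_chain (k : ℕ) (v : ℕ → M) (a : ℕ → E) (ℓ : ℕ → ℝ)
    (hℓ : ∀ i < k, 0 < ℓ i)
    (hdom : ∀ i < k, (a i : TangentSpace I (v i)) ∈ expDomain cov (v i))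
    (hexp : ∀ i < k, expMap cov (v i) (a i : TangentSpace I (v i)) = v (i + 1))
    (hmatch : ∀ i, i + 1 < k →
      (ℓ i)⁻¹ • (velocity I (fun r : ℝ ↦ expMap cov (v i) (r • (a i : TangentSpace I (v i)))) 1
        : E) = (ℓ (i + 1))⁻¹ • a (i + 1)) :
    Icc 0 (∑ i ∈ Finset.range k, ℓ i) ⊆
        maximalGeodesicDomain cov (v 0) ((ℓ 0)⁻¹ • (a 0 : TangentSpace I (v 0))) ∧
      ∀ i ≤ k, maximalGeodesic cov (v 0) ((ℓ 0)⁻¹ • (a 0 : TangentSpace I (v 0)))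
        (∑ j ∈ Finset.range i, ℓ j) = v i := by
  let e₀ : TangentSpace I (v 0) := (ℓ 0)⁻¹ • (a 0 : TangentSpace I (v 0))
  let Γ : ℝ → M := maximalGeodesic cov (v 0) e₀
  let t : ℕ → ℝ := fun i ↦ ∑ j ∈ Finset.range i, ℓ j
  obtain ⟨hMΓ, h0Γ, hΓ0, hΓv⟩ := maximalGeodesic_spec' (cov := cov) (v 0) e₀
  have hΓ0' : Γ 0 = v 0 := hΓ0
  have hΓv' : (velocity I Γ 0 : E) = e₀ := hΓv
  have ht0 : t 0 = 0 := Finset.sum_range_zero ℓ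
  have htsucc : ∀ i, t (i + 1) = t i + ℓ i := fun i ↦ Finset.sum_range_succ ℓ i
  have htnn : ∀ i ≤ k, 0 ≤ t i := fun i hi ↦
    Finset.sum_nonneg fun j hj ↦ (hℓ j (lt_of_lt_of_le (Finset.mem_range.1 hj) hi)).le
  -- the inductive statement
  have main : ∀ i, i ≤ k → Icc 0 (t i) ⊆ maximalGeodesicDomain cov (v 0) e₀ ∧ Γ (t i) = v i ∧
      (i < k → (velocity I Γ (t i) : E) = (ℓ i)⁻¹ • a i) := by
    intro i
    induction i with
    | zero =>
      intro _
      refine ⟨?_, by rw [ht0]; exact hΓ0', fun _ ↦ by rw [ht0]; exact hΓv'⟩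
      rw [ht0, Icc_self]
      exact singleton_subset_iff.2 h0Γ
    | succ i ih =>
      intro hi
      have hik : i < k := Nat.lt_of_succ_le hi
      obtain ⟨hD, hpos, hvel⟩ := ih hik.le
      have hvel' := hvel hik
      have hℓi : 0 < ℓ i := hℓ i hik
      -- the segment `i`
      let eᵢ : TangentSpace I (v i) := (ℓ i)⁻¹ • (a i : TangentSpace I (v i))
      obtain ⟨hMi, h0i, -, -⟩ := maximalGeodesic_spec' (cov := cov) (v i) (a i : TangentSpace I (v i))
      have hDi : Icc (0 : ℝ) 1 ⊆ maximalGeodesicDomain cov (v i) (a i : TangentSpace I (v i)) :=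
        hMi.2.1.out h0i (hdom i hik).2
      have hresc : ∀ s : ℝ, (ℓ i)⁻¹ * s ∈ maximalGeodesicDomain cov (v i) (a i : TangentSpace I (v i)) →
          s ∈ maximalGeodesicDomain cov (v i) eᵢ ∧
          maximalGeodesic cov (v i) eᵢ s =
            maximalGeodesic cov (v i) (a i : TangentSpace I (v i)) ((ℓ i)⁻¹ * s) :=
        fun s hs ↦ maximalGeodesic_smul_of_mem (cov := cov) (v i) _ (ℓ i)⁻¹ hs
      have hsdom : ∀ s ∈ Icc 0 (ℓ i),
          (ℓ i)⁻¹ * s ∈ maximalGeodesicDomain cov (v i) (a i : TangentSpace I (v i)) := by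
        intro s hs
        refine hDi ⟨mul_nonneg (inv_nonneg.2 hℓi.le) hs.1, ?_⟩
        rw [inv_mul_le_iff₀ hℓi, mul_one]
        exact hs.2
      -- the bundle point of `Γ` at `t i` is `(v i, eᵢ)`
      have hTL : tangentLift I Γ (t i) = TotalSpace.mk' E (v i) eᵢ := by
        refine Bundle.TotalSpace.ext hpos ?_
        exact heq_of_eq hvel'
      have hdomeq : maximalGeodesicDomain cov (Γ (t i)) (velocity I Γ (t i)) =
          maximalGeodesicDomain cov (v i) eᵢ :=
        congrArg (fun p : TangentBundle I M ↦ maximalGeodesicDomain cov p.proj p.2) hTL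
      have hgeoeq : maximalGeodesic cov (Γ (t i)) (velocity I Γ (t i)) =
          maximalGeodesic cov (v i) eᵢ :=
        congrArg (fun p : TangentBundle I M ↦ maximalGeodesic cov p.proj p.2) hTL
      have hti : t i ∈ maximalGeodesicDomain cov (v 0) e₀ := hD ⟨htnn i hik.le, le_rfl⟩
      -- translation
      have htrans : ∀ s ∈ Icc 0 (ℓ i), s + t i ∈ maximalGeodesicDomain cov (v 0) e₀ := by
        intro s hs
        have h1 : s ∈ maximalGeodesicDomain cov (Γ (t i)) (velocity I Γ (t i)) := by
          rw [hdomeq]; exact (hresc s (hsdom s hs)).1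
        exact add_mem_maximalGeodesicDomain_of_translate (cov := cov) (v 0) e₀ hti h1
      refine ⟨?_, ?_, fun hik' ↦ ?_⟩
      · -- domain
        intro r hr
        rcases le_or_gt r (t i) with h | h
        · exact hD ⟨hr.1, h⟩
        · have hs : r - t i ∈ Icc 0 (ℓ i) := ⟨by linarith, by rw [htsucc] at hr; linarith [hr.2]⟩
          have := htrans (r - t i) hs
          rwa [sub_add_cancel] at this
      · -- position
        have hℓdom : ℓ i + t i ∈ maximalGeodesicDomain cov (v 0) e₀ :=
          htrans (ℓ i) ⟨hℓi.le, le_rfl⟩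
        have htr : maximalGeodesic cov (Γ (t i)) (velocity I Γ (t i)) (ℓ i) = Γ (ℓ i + t i) :=
          maximalGeodesic_translate_apply (cov := cov) (v 0) e₀ hti hℓdom
        rw [htsucc, add_comm (t i) (ℓ i), ← htr, hgeoeq,
          (hresc (ℓ i) (hsdom (ℓ i) ⟨hℓi.le, le_rfl⟩)).2, inv_mul_cancel₀ hℓi.ne', ← hexp i hik]
        have h := (expMap_smul_of_mem (cov := cov) (v i) (a i : TangentSpace I (v i))
          (hdom i hik).2).2
        rw [one_smul] at h
        exact h.symm
      · -- velocity
        have hℓdom : ℓ i + t i ∈ maximalGeodesicDomain cov (v 0) e₀ :=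
          htrans (ℓ i) ⟨hℓi.le, le_rfl⟩
        have hvtr : (velocity I (maximalGeodesic cov (Γ (t i)) (velocity I Γ (t i))) (ℓ i) : E) =
            velocity I Γ (ℓ i + t i) :=
          velocity_maximalGeodesic_translate (cov := cov) (v 0) e₀ hti hℓdom
        have h1 : (velocity I Γ (t (i + 1)) : E) =
            velocity I (maximalGeodesic cov (Γ (t i)) (velocity I Γ (t i))) (ℓ i) := by
          rw [hvtr, htsucc, add_comm]
        have h2 : (velocity I (maximalGeodesic cov (Γ (t i)) (velocity I Γ (t i))) (ℓ i) : E) =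
            velocity I (maximalGeodesic cov (v i) eᵢ) (ℓ i) :=
          congrArg (fun γ : ℝ → M ↦ (velocity I γ (ℓ i) : E)) hgeoeq
        -- rescaling near `ℓ i`
        have hev : (maximalGeodesic cov (v i) eᵢ) =ᶠ[𝓝 (ℓ i)]
            fun s ↦ maximalGeodesic cov (v i) (a i : TangentSpace I (v i)) ((ℓ i)⁻¹ * s + 0) := by
          have hopen : IsOpen (maximalGeodesicDomain cov (v i) (a i : TangentSpace I (v i))) :=
            hMi.isOpen
          have hmem : (ℓ i)⁻¹ * ℓ i ∈ maximalGeodesicDomain cov (v i) (a i : TangentSpace I (v i)) :=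
            hsdom (ℓ i) ⟨hℓi.le, le_rfl⟩
          have hnear : ∀ᶠ s in 𝓝 (ℓ i),
              (ℓ i)⁻¹ * s ∈ maximalGeodesicDomain cov (v i) (a i : TangentSpace I (v i)) :=
            (continuous_const.mul continuous_id).continuousAt.preimage_mem_nhds (hopen.mem_nhds hmem)
          filter_upwards [hnear] with s hs
          rw [add_zero]; exact (hresc s hs).2
        have h3 : (velocity I (maximalGeodesic cov (v i) eᵢ) (ℓ i) : E) =
            (ℓ i)⁻¹ • velocity I (maximalGeodesic cov (v i) (a i : TangentSpace I (v i)))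
              ((ℓ i)⁻¹ * ℓ i + 0) := by
          have h := velocity_congr_of_eventuallyEq (I := I) hev
          -- `h : velocity (maximalGeodesic … eᵢ) (ℓ i) = velocity (fun s ↦ …) (ℓ i)`
          rw [h]
          exact velocity_comp_affine (maximalGeodesic cov (v i) (a i : TangentSpace I (v i)))
            (ℓ i)⁻¹ 0 (ℓ i)
        have h4 : (velocity I (maximalGeodesic cov (v i) (a i : TangentSpace I (v i)))
            ((ℓ i)⁻¹ * ℓ i + 0) : E) =
            velocity I (fun r : ℝ ↦ expMap cov (v i) (r • (a i : TangentSpace I (v i)))) 1 := by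
          rw [add_zero, inv_mul_cancel₀ hℓi.ne']
          refine velocity_congr_of_eventuallyEq ?_
          filter_upwards [hMi.isOpen.mem_nhds (hdom i hik).2] with r hr
          exact ((expMap_smul_of_mem (cov := cov) (v i) (a i : TangentSpace I (v i)) hr).2).symm
        rw [h1, h2, h3, h4]
        exact hmatch i hik'
  refine ⟨(main k le_rfl).1, fun i hi ↦ (main i hi).2.1⟩

end Concat

/-! ### Maximal geodesics from a compact set -/

namespace LorentzianMetric

variable {n : ℕ∞ω} {g : LorentzianMetric I n M} [SecondCountableTopology M] [I.Boundaryless]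
  [g.HasLeviCivita] [CovariantDerivative.ContMDiffCovariantDerivative g.leviCivita 1]
  (τ : TimeOrientation g)

omit [FiniteDimensional ℝ E] [CompleteSpace E] [T2Space M] [SecondCountableTopology M]
  [I.Boundaryless] [g.HasLeviCivita]
  [CovariantDerivative.ContMDiffCovariantDerivative g.leviCivita 1] in
/-- **Chain form of the reverse triangle inequality**: along a causal chain
`v i ≤ v (i+1) ≤ ⋯ ≤ v j` one has `∑_{i ≤ m < j} τ(v m, v (m+1)) ≤ τ(v i, v j)`.
[cite: ONeillSemiRiemannian1983, Ch. 14, Lemma 14.16 (2) (p. 409)] -/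
theorem sum_lorentzDist_le_of_chain (hn : (2 : ℕ∞ω) ≤ n) {v : ℕ → M}
    (hv : ∀ i, v (i + 1) ∈ g.causalFuture τ {v i}) {i j : ℕ} (hij : i ≤ j) :
    ∑ m ∈ Finset.Ico i j, g.lorentzDist τ (v m) (v (m + 1)) ≤ g.lorentzDist τ (v i) (v j) := by
  have hn1 : (1 : ℕ∞ω) ≤ n := le_trans (by exact_mod_cast one_le_two) hn
  induction hij with
  | refl => simp
  | @step m hm ih =>
    rw [Finset.sum_Ico_succ_top hm]
    calc ∑ k ∈ Finset.Ico i m, g.lorentzDist τ (v k) (v (k + 1)) + g.lorentzDist τ (v m) (v (m + 1))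
        ≤ g.lorentzDist τ (v i) (v m) + g.lorentzDist τ (v m) (v (m + 1)) := add_le_add ih le_rfl
      _ ≤ g.lorentzDist τ (v i) (v (m + 1)) :=
          lorentzDist_add_lorentzDist_le hn1 (mem_causalFuture_of_chain hn hv hm) (hv m)

set_option maxHeartbeats 4000000 in
/-- **Maximal timelike geodesic from a compact set** (O'Neill 1983, Ch. 14, Thm. 14.44, first
half, with Prop. 14.19, Lemma 14.14 and Prop. 10.46). Let `(M, g, τ)` be strongly causal with a
smooth metric, `A` compact, `q` a point such that every future causal curve from `A` to `q` lies
in the compact set `K`, and suppose `τ(p, q) > 0` for some `p ∈ A`. Then there are `p₀ ∈ A`, a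
future-directed unit timelike vector `u ∈ T_{p₀}M` and `T > 0` such that the geodesic `γ_u` is
defined on `[0, T]`, `γ_u(T) = q`, and `τ(p, q) ≤ T` for every `p ∈ A` (so that `γ_u|[0, T]`, of
length `T`, is a maximal causal curve from `A` to `q`). See the module docstring for the proof.
[cite: ONeillSemiRiemannian1983, Ch. 14, Thm. 14.44 (p. 427) and Prop. 14.19 (p. 411)] -/
theorem exists_maximal_geodesic_of_isCompact (hn : (∞ : ℕ∞ω) ≤ n) (hsc : g.IsStronglyCausal τ)
    {A K : Set M} (hA : IsCompact A) (hK : IsCompact K) {q : M}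
    (hAK : ∀ (γ : ℝ → M) (a b : ℝ), a ≤ b → g.IsFutureCausalCurveOn τ γ (Icc a b) → γ a ∈ A →
      γ b = q → MapsTo γ (Icc a b) K)
    (hpos : ∃ p ∈ A, 0 < g.lorentzDist τ p q) :
    ∃ p₀ ∈ A, ∃ (u : TangentSpace I p₀) (T : ℝ), 0 < T ∧
      Icc 0 T ⊆ maximalGeodesicDomain g.leviCivita p₀ u ∧ g.val p₀ u u = -1 ∧
      τ.IsFutureDirected u ∧ maximalGeodesic g.leviCivita p₀ u T = q ∧
      ∀ p ∈ A, g.lorentzDist τ p q ≤ ENNReal.ofReal T := by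
  classical
  haveI : Fact (1 ≤ n) := ⟨le_trans (by exact_mod_cast le_top) hn⟩
  have hn1 : (1 : ℕ∞ω) ≤ n := Fact.out
  have hn2 : (2 : ℕ∞ω) ≤ n :=
    le_trans (WithTop.coe_le_coe.mpr le_top : (2 : ℕ∞ω) ≤ ((⊤ : ℕ∞) : ℕ∞ω)) hn
  have hcausal : g.IsCausallyWellBehaved τ :=
    IsStronglyCausal.isCausallyWellBehaved_holds (g := g) (τ := τ) hsc
  /- ■ 1. the maximising sequence -/
  let S : Set ℝ≥0∞ := {L | ∃ p ∈ A, ∃ (γ : ℝ → M) (a b : ℝ), a < b ∧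
    g.IsFutureCausalCurveOn τ γ (Icc a b) ∧ γ a = p ∧ γ b = q ∧ L = g.arcLength γ a b}
  obtain ⟨p₁, hp₁, hpos₁⟩ := hpos
  have hSne : S.Nonempty := by
    obtain ⟨γ, a, b, hab, hγ, ha, hb, -⟩ := lt_lorentzDist_iff.1 hpos₁
    exact ⟨_, p₁, hp₁, γ, a, b, hab, hγ, ha, hb, rfl⟩
  let Tsup : ℝ≥0∞ := sSup S
  have hdle : ∀ p ∈ A, g.lorentzDist τ p q ≤ Tsup := fun p hp ↦
    lorentzDist_le_iff.2 fun γ a b hab hγ ha hb ↦ le_sSup ⟨p, hp, γ, a, b, hab, hγ, ha, hb, rfl⟩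
  have hTpos : 0 < Tsup := lt_of_lt_of_le hpos₁ (hdle p₁ hp₁)
  obtain ⟨useq, -, hulim, huS⟩ := exists_seq_tendsto_sSup hSne (OrderTop.bddAbove S)
  choose pm hpm γm am bm habm hγm hγam hγbm hLm using huS
  -- reparametrise to `[0, b m]`
  let α : ℕ → ℝ → M := fun m s ↦ γm m (s + am m)
  let b : ℕ → ℝ := fun m ↦ bm m - am m
  have hbpos : ∀ m, 0 < b m := fun m ↦ sub_pos.2 (habm m)
  have hα : ∀ m, g.IsFutureCausalCurveOn τ (α m) (Icc 0 (b m)) := by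
    intro m
    have h := (hγm m).comp_add_const (am m)
    rwa [sub_self] at h
  have hα0 : ∀ m, α m 0 = pm m := fun m ↦ by simp only [α, zero_add]; exact hγam m
  have hαb : ∀ m, α m (b m) = q := fun m ↦ by simp only [α, b, sub_add_cancel]; exact hγbm m
  have hαL : ∀ m, g.arcLength (α m) 0 (b m) = useq m := by
    intro m
    rw [hLm m]
    have h := PseudoRiemannianMetric.arcLength_comp_add_const (g := g.toPseudoRiemannianMetric)
      (γm m) (am m) 0 (b m)
    simp only [b, zero_add, sub_add_cancel] at h
    exact h
  have hαK : ∀ m, MapsTo (α m) (Icc 0 (b m)) K := fun m ↦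
    hAK (α m) 0 (b m) (hbpos m).le (hα m) (by rw [hα0]; exact hpm m) (hαb m)
  -- a free ultrafilter and the limit of the initial points
  let 𝒰 : Ultrafilter ℕ := hyperfilter ℕ
  have h𝒰 : (𝒰 : Filter ℕ) ≤ atTop := by
    rw [← Nat.cofinite_eq_atTop]; exact hyperfilter_le_cofinite
  have hle : (↑(𝒰.map fun m ↦ α m 0) : Filter M) ≤ 𝓟 A := by
    rw [Ultrafilter.coe_map, le_principal_iff, mem_map]
    exact Eventually.of_forall fun m ↦ show α m 0 ∈ A by rw [hα0]; exact hpm m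
  obtain ⟨p₀, hp₀A, hp₀⟩ := hA.ultrafilter_le_nhds _ hle
  have hp₀' : Tendsto (fun m ↦ α m 0) (𝒰 : Filter ℕ) (𝓝 p₀) := by
    rw [Ultrafilter.coe_map] at hp₀; exact hp₀
  /- ■ 2. the limit chain -/
  choose W Ξ hWo hcW hWsrc hΞs hΞ hform using fun c : M ↦ exists_nhds_lorentzDist_eq_radial τ hn c
  choose U hUo hcU hUW hUcc using fun c : M ↦
    hsc.exists_causallyConvex_nhds hn1 c ((hWo c).mem_nhds (hcW c))
  obtain ⟨k, v, cc, w, hv0, hvk, hdist, hpairs, hbound⟩ :=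
    exists_limit_chain_arcLength_le τ hn hsc 𝒰
      (Eventually.of_forall fun m ↦ ⟨(hbpos m).le, hα m⟩) hK
      (Eventually.of_forall fun m ↦ hαK m) U (fun c ↦ (hUo c).mem_nhds (hcU c)) hp₀'
  have hvkq : v k = q := by
    have h : Tendsto (fun m ↦ α m (b m)) (𝒰 : Filter ℕ) (𝓝 q) := by
      have : (fun m ↦ α m (b m)) = fun _ ↦ q := funext fun m ↦ hαb m
      rw [this]; exact tendsto_const_nhds
    exact tendsto_nhds_unique hvk h
  -- abbreviations
  let d : ℕ → ℝ≥0∞ := fun i ↦ g.lorentzDist τ (v i) (v (i + 1))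
  let ℓF : ℕ → ℝ := fun i ↦ Real.sqrt (-g.val (v i) (w i) (w i))
  have hℓFd : ∀ i < k, ENNReal.ofReal (ℓF i) ≤ d i := fun i hi ↦ (hpairs i hi).2.2.2.2.2.2.2
  -- `Tsup ≤ ∑ ofReal ℓF ≤ ∑ d`
  have hTF : Tsup ≤ ∑ i ∈ Finset.range k, ENNReal.ofReal (ℓF i) := by
    by_contra hlt
    rw [not_le] at hlt
    obtain ⟨L, hL1, hL2⟩ := exists_between hlt
    have hev : ∀ᶠ m in atTop, L < useq m := hulim.eventually (lt_mem_nhds hL2)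
    have hev' : ∀ᶠ m in (𝒰 : Filter ℕ), L ≤ g.arcLength (α m) 0 (b m) := by
      filter_upwards [h𝒰 hev] with m hm
      rw [hαL m]; exact hm.le
    exact absurd (hbound L hev') (not_le.2 hL1)
  have hFtop : ∑ i ∈ Finset.range k, ENNReal.ofReal (ℓF i) ≠ ⊤ :=
    ENNReal.sum_ne_top.2 fun i _ ↦ ENNReal.ofReal_ne_top
  have hTtop : Tsup ≠ ⊤ := ne_top_of_le_ne_top hFtop hTF
  have hFd : ∑ i ∈ Finset.range k, ENNReal.ofReal (ℓF i) ≤ ∑ i ∈ Finset.range k, d i :=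
    Finset.sum_le_sum fun i hi ↦ hℓFd i (Finset.mem_range.1 hi)
  /- ■ 3. the chain inequalities -/
  -- the extended chain and its causal relations
  let vx : ℕ → M := fun i ↦ v (min i k)
  have hvx : ∀ i, vx (i + 1) ∈ g.causalFuture τ {vx i} := by
    intro i
    by_cases hi : i + 1 ≤ k
    · have h1 : min (i + 1) k = i + 1 := min_eq_left hi
      have h2 : min i k = i := min_eq_left (Nat.le_of_succ_le hi)
      simp only [vx, h1, h2]
      exact (hpairs i (Nat.lt_of_succ_le hi)).2.2.2.2.2.2.1
    · have h1 : min (i + 1) k = k := min_eq_right (by omega)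
      have h2 : min i k = k := min_eq_right (by omega)
      simp only [vx, h1, h2]
      exact subset_causalFuture g τ _ (mem_singleton _)
  have hrel : ∀ i j, i ≤ j → j ≤ k → v j ∈ g.causalFuture τ {v i} := by
    intro i j hij hjk
    have h := mem_causalFuture_of_chain hn2 hvx hij
    simp only [vx, min_eq_left hjk, min_eq_left (hij.trans hjk)] at h
    exact h
  have hchain : ∀ i j, i ≤ j → j ≤ k →
      ∑ m ∈ Finset.Ico i j, d m ≤ g.lorentzDist τ (v i) (v j) := by
    intro i j hij hjk
    have h := sum_lorentzDist_le_of_chain τ hn2 hvx hij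
    have heq : ∀ m ∈ Finset.Ico i j, g.lorentzDist τ (vx m) (vx (m + 1)) = d m := by
      intro m hm
      have hm' : m + 1 ≤ k := Nat.succ_le_of_lt (lt_of_lt_of_le (Finset.mem_Ico.1 hm).2 hjk)
      simp only [vx, d, min_eq_left hm', min_eq_left (Nat.le_of_succ_le hm')]
    rw [Finset.sum_congr rfl heq] at h
    simp only [vx, min_eq_left hjk, min_eq_left (hij.trans hjk)] at h
    exact h
  -- everything is an equality
  have hsum_le : ∑ i ∈ Finset.range k, d i ≤ Tsup := by
    have h := hchain 0 k (Nat.zero_le k) le_rfl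
    rw [Finset.range_eq_Ico] 
    refine h.trans ?_
    rw [hv0, hvkq]
    exact hdle p₀ hp₀A
  have hdeq : ∀ i ∈ Finset.range k, d i = ENNReal.ofReal (ℓF i) :=
    ENNReal.eq_of_sum_le_of_le (fun i hi ↦ hℓFd i (Finset.mem_range.1 hi))
      (hsum_le.trans hTF) hFtop
  have hTeq : Tsup = ∑ i ∈ Finset.range k, d i :=
    le_antisymm (hTF.trans hFd) hsum_le
  /- ■ 4. drop a degenerate last segment -/
  obtain ⟨k', hk'k, hvk', hnd, hTk'⟩ : ∃ k', k' ≤ k ∧ v k' = q ∧ (∀ i < k', v (i + 1) ≠ v i) ∧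
      Tsup ≤ ∑ i ∈ Finset.range k', d i := by
    by_cases hk0 : k = 0
    · refine ⟨0, Nat.zero_le k, by rw [← hk0]; exact hvkq, fun i hi ↦ absurd hi (Nat.not_lt_zero i), ?_⟩
      rw [hTeq, hk0]
    · obtain ⟨k₁, rfl⟩ : ∃ k₁, k = k₁ + 1 := Nat.exists_eq_succ_of_ne_zero hk0
      by_cases hdeg : v (k₁ + 1) = v k₁
      · refine ⟨k₁, Nat.le_succ k₁, by rw [← hdeg]; exact hvkq, fun i hi ↦ hdist i (by omega), ?_⟩
        rw [hTeq, Finset.sum_range_succ]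
        have h0 : d k₁ = 0 := by
          show g.lorentzDist τ (v k₁) (v (k₁ + 1)) = 0
          rw [hdeg]; exact lorentzDist_self_of_isCausallyWellBehaved hcausal _
        rw [h0, add_zero]
      · refine ⟨k₁ + 1, le_rfl, hvkq, fun i hi ↦ ?_, by rw [hTeq]⟩
        rcases Nat.lt_succ_iff_lt_or_eq.1 hi with h | h
        · exact hdist i (by omega)
        · rw [h]; exact hdeg
  have hsum_le' : ∑ i ∈ Finset.range k', d i ≤ Tsup := by
    have h := hchain 0 k' (Nat.zero_le k') hk'k
    rw [Finset.range_eq_Ico]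
    refine h.trans ?_
    rw [hv0, hvk']
    exact hdle p₀ hp₀A
  have hTeq' : Tsup = ∑ i ∈ Finset.range k', d i := le_antisymm hTk' hsum_le'
  have hd0q : g.lorentzDist τ (v 0) q = Tsup :=
    le_antisymm (by rw [hv0]; exact hdle p₀ hp₀A)
      (by rw [hTeq', ← hvk', Finset.range_eq_Ico]; exact hchain 0 k' (Nat.zero_le k') hk'k)
  /- ■ 5. the maximal radial segments -/
  let e : M → _ := fun c : M ↦ trivializationAt E (TangentSpace I : M → Type _) c
  let a : (i : ℕ) → TangentSpace I (v i) := fun i ↦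
    (e (cc i)).symmL ℝ (v i) (Ξ (cc i) (v i) (v (i + 1)))
  let ℓ : ℕ → ℝ := fun i ↦ Real.sqrt (-g.val (v i) (a i) (a i))
  have hseg : ∀ i < k', (a i : TangentSpace I (v i)) ∈ expDomain g.leviCivita (v i) ∧
      expMap g.leviCivita (v i) (a i : TangentSpace I (v i)) = v (i + 1) ∧
      τ.IsFutureDirected (x := v i) (a i) ∧ d i = ENNReal.ofReal (ℓ i) := by
    intro i hi
    have hik : i < k := lt_of_lt_of_le hi hk'k
    obtain ⟨hvU, hvU', -, -, -, -, hJ, -⟩ := hpairs i hik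
    obtain ⟨hdom, hexp⟩ := hΞ (cc i) (v i) (hUW _ hvU) (v (i + 1)) (hUW _ hvU')
    obtain ⟨hfut, -, hdist', -⟩ := hform (cc i) (U (cc i)) (hUW _) (hUcc _) (v i) hvU (v (i + 1)) hvU'
      hJ (hnd i hi)
    exact ⟨hdom, hexp, hfut, hdist'⟩
  have hℓnn : ∀ i, 0 ≤ ℓ i := fun i ↦ Real.sqrt_nonneg _
  have hQle : ∀ i < k', g.val (v i) (a i) (a i) ≤ 0 := fun i hi ↦ (hseg i hi).2.2.1.1.1
  have hℓsq : ∀ i < k', ℓ i ^ 2 = -g.val (v i) (a i) (a i) := fun i hi ↦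
    Real.sq_sqrt (by linarith [hQle i hi])
  -- the total length
  let Stot : ℝ := ∑ i ∈ Finset.range k', ℓ i
  have hStot : ENNReal.ofReal Stot = Tsup := by
    rw [hTeq', ENNReal.ofReal_sum_of_nonneg fun i _ ↦ hℓnn i]
    exact (Finset.sum_congr rfl fun i hi ↦ (hseg i (Finset.mem_range.1 hi)).2.2.2).symm
  have hStot_pos : 0 < Stot := by
    have h : (0 : ℝ≥0∞) < ENNReal.ofReal Stot := by rw [hStot]; exact hTpos
    exact ENNReal.ofReal_pos.1 h
  have hk'pos : 0 < k' := by
    by_contra h0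
    have hk'0 : k' = 0 := by omega
    have : Stot = 0 := by simp only [Stot, hk'0, Finset.sum_range_zero]
    linarith
  /- ■ 6. the radial curves and the local maximality at the vertices -/
  let ρ : ℕ → ℝ → M := fun i r ↦ expMap g.leviCivita (v i) (r • (a i : TangentSpace I (v i)))
  have hρ : ∀ i < k', g.IsFutureCausalCurveOn τ (ρ i) (Icc 0 1) := fun i hi ↦
    isFutureCausalCurveOn_expMap_smul τ (hseg i hi).1 (hseg i hi).2.2.1
  have hρ0 : ∀ i, ρ i 0 = v i := fun i ↦ by
    simp only [ρ, zero_smul]; exact expMap_zero (cov := g.leviCivita) (v i)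
  have hρ1 : ∀ i < k', ρ i 1 = v (i + 1) := fun i hi ↦ by
    simp only [ρ, one_smul]; exact (hseg i hi).2.1
  have hspeed : ∀ i < k', ∀ r ∈ Icc (0 : ℝ) 1, g.speed (ρ i) r = ℓ i := by
    intro i hi r hr
    obtain ⟨hMi, h0i, hγ0, hγv⟩ :=
      maximalGeodesic_spec' (cov := g.leviCivita) (v i) (a i : TangentSpace I (v i))
    have hDi : Icc (0 : ℝ) 1 ⊆ maximalGeodesicDomain g.leviCivita (v i) (a i : TangentSpace I (v i)) :=
      hMi.2.1.out h0i (hseg i hi).1.2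
    have hrD := hDi hr
    have hvel : velocity I (ρ i) r = velocity I (maximalGeodesic g.leviCivita (v i)
        (a i : TangentSpace I (v i))) r := by
      refine velocity_congr_of_eventuallyEq ?_
      filter_upwards [hMi.isOpen.mem_nhds hrD] with s hs
      exact (expMap_smul_of_mem (cov := g.leviCivita) (v i) (a i : TangentSpace I (v i)) hs).2
    have hcs := g.toPseudoRiemannianMetric.val_velocity_eq_of_isGeodesicOn_holds hMi.isOpen
      hMi.2.1 hMi.isGeodesicOn hrD h0i
    rw [hγv, hγ0] at hcs
    have hbase : ρ i r = maximalGeodesic g.leviCivita (v i) (a i : TangentSpace I (v i)) r :=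
      (expMap_smul_of_mem (cov := g.leviCivita) (v i) (a i : TangentSpace I (v i)) hrD).2
    have hval : g.val (ρ i r) (velocity I (ρ i) r) (velocity I (ρ i) r) = g.val (v i) (a i) (a i) := by
      rw [hvel, hbase]; exact hcs
    rw [PseudoRiemannianMetric.speed_eq_sqrt_neg_of_nonpos (by rw [hval]; exact hQle i hi), hval]
  have hlen : ∀ i < k', ∀ s₁ s₂ : ℝ, 0 ≤ s₁ → s₁ ≤ s₂ → s₂ ≤ 1 →
      g.arcLength (ρ i) s₁ s₂ = ENNReal.ofReal (ℓ i * (s₂ - s₁)) := by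
    intro i hi s₁ s₂ h1 h12 h2
    exact PseudoRiemannianMetric.arcLength_eq_of_speed_eq h12 fun t ht ↦
      hspeed i hi t ⟨h1.trans ht.1, ht.2.trans h2⟩
  have h3pt : ∀ i, i + 2 ≤ k' → ∀ δ ∈ Ioo (0 : ℝ) 1, ∀ y' : M,
      y' ∈ g.causalFuture τ {expMap g.leviCivita (v i) ((1 - δ) • (a i : TangentSpace I (v i)))} →
      expMap g.leviCivita (v (i + 1)) (δ • (a (i + 1) : TangentSpace I (v (i + 1)))) ∈
        g.causalFuture τ {y'} →
      g.lorentzDist τ (expMap g.leviCivita (v i) ((1 - δ) • (a i : TangentSpace I (v i)))) y' +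
          g.lorentzDist τ y' (expMap g.leviCivita (v (i + 1))
            (δ • (a (i + 1) : TangentSpace I (v (i + 1))))) ≤
        ENNReal.ofReal (δ * Real.sqrt (-g.val (v i) (a i) (a i)) +
          δ * Real.sqrt (-g.val (v (i + 1)) (a (i + 1)) (a (i + 1)))) := by
    intro i hi2 δ hδ y' hy'1 hy'2
    have hi : i < k' := by omega
    have hi1 : i + 1 < k' := by omega
    -- the points
    have hx' : expMap g.leviCivita (v i) ((1 - δ) • (a i : TangentSpace I (v i))) = ρ i (1 - δ) := rfl
    have hz' : expMap g.leviCivita (v (i + 1)) (δ • (a (i + 1) : TangentSpace I (v (i + 1)))) =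
        ρ (i + 1) δ := rfl
    rw [hx'] at hy'1 ⊢
    rw [hz'] at hy'2 ⊢
    -- causal relations
    have hρ₁' : g.IsFutureCausalCurveOn τ (ρ i) (Icc 0 (1 - δ)) :=
      (hρ i hi).mono (Icc_subset_Icc le_rfl (by linarith [hδ.1]))
    have hρ₂' : g.IsFutureCausalCurveOn τ (ρ (i + 1)) (Icc δ 1) :=
      (hρ (i + 1) hi1).mono (Icc_subset_Icc hδ.1.le le_rfl)
    have hz'v : v (i + 2) ∈ g.causalFuture τ {ρ (i + 1) δ} := by
      have h := _root_.Literature.Geometry.Lorentzian.IsFutureCausalCurveOn.apply_mem_causalFuture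
        τ hδ.2.le hρ₂'
      rwa [hρ1 (i + 1) hi1] at h
    have hqv2 : q ∈ g.causalFuture τ {v (i + 2)} := by
      rw [← hvk']; exact hrel (i + 2) k' hi2 hk'k
    have hqz' : q ∈ g.causalFuture τ {ρ (i + 1) δ} :=
      mem_causalFuture_of_mem_causalFuture_of_mem_causalFuture hn2 hz'v hqv2
    have hqy' : q ∈ g.causalFuture τ {y'} :=
      mem_causalFuture_of_mem_causalFuture_of_mem_causalFuture hn2 hy'2 hqz'
    have hqx' : q ∈ g.causalFuture τ {ρ i (1 - δ)} :=
      mem_causalFuture_of_mem_causalFuture_of_mem_causalFuture hn2 hy'1 hqy'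
    have hqvi : q ∈ g.causalFuture τ {v i} := by
      rw [← hvk']; exact hrel i k' hi.le hk'k
    have hviv0 : v i ∈ g.causalFuture τ {v 0} := hrel 0 i (Nat.zero_le i) (hi.le.trans hk'k)
    -- the reverse triangle inequalities
    have S2 : g.lorentzDist τ (v 0) (v i) + g.lorentzDist τ (v i) q ≤ Tsup := by
      rw [← hd0q]; exact lorentzDist_add_lorentzDist_le hn1 hviv0 hqvi
    have S3 : g.arcLength (ρ i) 0 (1 - δ) + g.lorentzDist τ (ρ i (1 - δ)) q ≤
        g.lorentzDist τ (v i) q := by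
      have h := arcLength_add_lorentzDist_le hn1 (by linarith [hδ.2]) hρ₁' hqx'
      rwa [hρ0 i] at h
    have S4 : g.lorentzDist τ (ρ i (1 - δ)) y' + g.lorentzDist τ y' q ≤
        g.lorentzDist τ (ρ i (1 - δ)) q := lorentzDist_add_lorentzDist_le hn1 hy'1 hqy'
    have S5 : g.lorentzDist τ y' (ρ (i + 1) δ) + g.lorentzDist τ (ρ (i + 1) δ) q ≤
        g.lorentzDist τ y' q := lorentzDist_add_lorentzDist_le hn1 hy'2 hqz'
    have S6 : g.arcLength (ρ (i + 1)) δ 1 + g.lorentzDist τ (v (i + 2)) q ≤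
        g.lorentzDist τ (ρ (i + 1) δ) q := by
      have h := arcLength_add_lorentzDist_le hn1 hδ.2 hρ₂' (by rw [hρ1 (i + 1) hi1]; exact hqv2)
      rwa [hρ1 (i + 1) hi1] at h
    have S1 : ∑ m ∈ Finset.range i, d m ≤ g.lorentzDist τ (v 0) (v i) := by
      rw [Finset.range_eq_Ico]; exact hchain 0 i (Nat.zero_le i) (hi.le.trans hk'k)
    have S7 : ∑ m ∈ Finset.Ico (i + 2) k', d m ≤ g.lorentzDist τ (v (i + 2)) q := by
      rw [← hvk']; exact hchain (i + 2) k' hi2 hk'k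
    -- combine
    let D : ℝ≥0∞ := g.lorentzDist τ (ρ i (1 - δ)) y' + g.lorentzDist τ y' (ρ (i + 1) δ)
    let L₁ : ℝ≥0∞ := g.arcLength (ρ i) 0 (1 - δ)
    let L₂ : ℝ≥0∞ := g.arcLength (ρ (i + 1)) δ 1
    have T1 : D + g.lorentzDist τ (ρ (i + 1) δ) q ≤ g.lorentzDist τ (ρ i (1 - δ)) q :=
      calc D + g.lorentzDist τ (ρ (i + 1) δ) q
          = g.lorentzDist τ (ρ i (1 - δ)) y' +
              (g.lorentzDist τ y' (ρ (i + 1) δ) + g.lorentzDist τ (ρ (i + 1) δ) q) := add_assoc _ _ _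
        _ ≤ g.lorentzDist τ (ρ i (1 - δ)) y' + g.lorentzDist τ y' q := add_le_add le_rfl S5
        _ ≤ g.lorentzDist τ (ρ i (1 - δ)) q := S4
    have T2 : L₁ + D + (L₂ + g.lorentzDist τ (v (i + 2)) q) ≤ g.lorentzDist τ (v i) q :=
      calc L₁ + D + (L₂ + g.lorentzDist τ (v (i + 2)) q)
          ≤ L₁ + D + g.lorentzDist τ (ρ (i + 1) δ) q := add_le_add le_rfl S6
        _ = L₁ + (D + g.lorentzDist τ (ρ (i + 1) δ) q) := add_assoc _ _ _
        _ ≤ L₁ + g.lorentzDist τ (ρ i (1 - δ)) q := add_le_add le_rfl T1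
        _ ≤ g.lorentzDist τ (v i) q := S3
    have T3 : ∑ m ∈ Finset.range i, d m + (L₁ + D + (L₂ + ∑ m ∈ Finset.Ico (i + 2) k', d m)) ≤
        Tsup :=
      calc ∑ m ∈ Finset.range i, d m + (L₁ + D + (L₂ + ∑ m ∈ Finset.Ico (i + 2) k', d m))
          ≤ g.lorentzDist τ (v 0) (v i) + (L₁ + D + (L₂ + g.lorentzDist τ (v (i + 2)) q)) :=
            add_le_add S1 (add_le_add le_rfl (add_le_add le_rfl S7))
        _ ≤ g.lorentzDist τ (v 0) (v i) + g.lorentzDist τ (v i) q := add_le_add le_rfl T2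
        _ ≤ Tsup := S2
    -- in real numbers
    let R' : ℝ := ∑ m ∈ Finset.range i, ℓ m + ℓ i * (1 - δ) + ℓ (i + 1) * (1 - δ) +
      ∑ m ∈ Finset.Ico (i + 2) k', ℓ m
    have hn₁ : 0 ≤ ∑ m ∈ Finset.range i, ℓ m := Finset.sum_nonneg fun m _ ↦ hℓnn m
    have hn₂ : 0 ≤ ∑ m ∈ Finset.Ico (i + 2) k', ℓ m := Finset.sum_nonneg fun m _ ↦ hℓnn m
    have hn₃ : 0 ≤ ℓ i * (1 - δ) := mul_nonneg (hℓnn i) (by linarith [hδ.2])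
    have hn₄ : 0 ≤ ℓ (i + 1) * (1 - δ) := mul_nonneg (hℓnn (i + 1)) (by linarith [hδ.2])
    have hR'nn : 0 ≤ R' := add_nonneg (add_nonneg (add_nonneg hn₁ hn₃) hn₄) hn₂
    have hR : ∑ m ∈ Finset.range i, d m + (L₁ + (L₂ + ∑ m ∈ Finset.Ico (i + 2) k', d m)) =
        ENNReal.ofReal R' := by
      have hL₁ : L₁ = ENNReal.ofReal (ℓ i * (1 - δ)) := by
        have h := hlen i hi 0 (1 - δ) le_rfl (by linarith [hδ.2]) (by linarith [hδ.1])
        rwa [sub_zero] at h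
      have hL₂ : L₂ = ENNReal.ofReal (ℓ (i + 1) * (1 - δ)) :=
        hlen (i + 1) hi1 δ 1 hδ.1.le hδ.2.le le_rfl
      have hs1 : ∑ m ∈ Finset.range i, d m = ENNReal.ofReal (∑ m ∈ Finset.range i, ℓ m) := by
        rw [ENNReal.ofReal_sum_of_nonneg fun m _ ↦ hℓnn m]
        exact Finset.sum_congr rfl fun m hm ↦
          (hseg m ((Finset.mem_range.1 hm).trans hi)).2.2.2
      have hs2 : ∑ m ∈ Finset.Ico (i + 2) k', d m =
          ENNReal.ofReal (∑ m ∈ Finset.Ico (i + 2) k', ℓ m) := by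
        rw [ENNReal.ofReal_sum_of_nonneg fun m _ ↦ hℓnn m]
        exact Finset.sum_congr rfl fun m hm ↦ (hseg m (Finset.mem_Ico.1 hm).2).2.2.2
      rw [hL₁, hL₂, hs1, hs2, ← ENNReal.ofReal_add hn₄ hn₂,
        ← ENNReal.ofReal_add hn₃ (add_nonneg hn₄ hn₂),
        ← ENNReal.ofReal_add hn₁ (add_nonneg hn₃ (add_nonneg hn₄ hn₂))]
      congr 1
      simp only [R']; ring
    have hRD : ENNReal.ofReal R' + D ≤ Tsup := by
      rw [← hR]
      have heq : ∑ m ∈ Finset.range i, d m + (L₁ + (L₂ + ∑ m ∈ Finset.Ico (i + 2) k', d m)) + D =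
          ∑ m ∈ Finset.range i, d m + (L₁ + D + (L₂ + ∑ m ∈ Finset.Ico (i + 2) k', d m)) := by
        ring
      rw [heq]; exact T3
    have hStot_split : Stot = R' + (δ * ℓ i + δ * ℓ (i + 1)) := by
      simp only [Stot, R']
      rw [← Finset.sum_range_add_sum_Ico ℓ hi2, Finset.sum_range_succ, Finset.sum_range_succ]
      ring
    calc D ≤ Tsup - ENNReal.ofReal R' := ENNReal.le_sub_of_add_le_left ENNReal.ofReal_ne_top hRD
      _ = ENNReal.ofReal (δ * ℓ i + δ * ℓ (i + 1)) := by
          have hpos2 : 0 ≤ δ * ℓ i + δ * ℓ (i + 1) :=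
            add_nonneg (mul_nonneg hδ.1.le (hℓnn _)) (mul_nonneg hδ.1.le (hℓnn _))
          rw [← hStot, hStot_split, ENNReal.ofReal_add hR'nn hpos2, ENNReal.add_sub_cancel_left
            ENNReal.ofReal_ne_top]
  /- ■ 7. all segments are timelike; matching tangents -/
  have hvert : ∀ i, i + 2 ≤ k' →
      (g.val (v i) (a i) (a i) < 0 ↔ g.val (v (i + 1)) (a (i + 1)) (a (i + 1)) < 0) ∧
      (g.val (v (i + 1)) (a (i + 1)) (a (i + 1)) < 0 →
        (ℓ i)⁻¹ • (velocity I (ρ i) 1 : E) = (ℓ (i + 1))⁻¹ • (a (i + 1) : E)) := by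
    intro i hi2
    have hi : i < k' := by omega
    have hi1 : i + 1 < k' := by omega
    exact vertex_of_maximal τ hn hsc (hseg i hi).1 (hseg i hi).2.1 (hseg i hi).2.2.1
      (hseg (i + 1) hi1).1 (hseg (i + 1) hi1).2.2.1 (h3pt i hi2)
  have hQiff : ∀ i, i < k' → (g.val (v i) (a i) (a i) < 0 ↔ g.val (v 0) (a 0) (a 0) < 0) := by
    intro i
    induction i with
    | zero => intro _; exact Iff.rfl
    | succ i ih =>
      intro hi1
      exact (hvert i (by omega)).1.symm.trans (ih (by omega))
  obtain ⟨j, hj, hℓj⟩ : ∃ j < k', 0 < ℓ j := by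
    by_contra h
    push Not at h
    have : Stot ≤ 0 := Finset.sum_nonpos fun m hm ↦ h m (Finset.mem_range.1 hm)
    linarith
  have hQj : g.val (v j) (a j) (a j) < 0 := by
    have h := Real.sqrt_pos.1 hℓj
    linarith
  have hQall : ∀ i < k', g.val (v i) (a i) (a i) < 0 := fun i hi ↦
    (hQiff i hi).2 ((hQiff j hj).1 hQj)
  have hℓpos : ∀ i < k', 0 < ℓ i := fun i hi ↦ Real.sqrt_pos.2 (by linarith [hQall i hi])
  have hmatch : ∀ i, i + 1 < k' →
      (ℓ i)⁻¹ • (velocity I (ρ i) 1 : E) = (ℓ (i + 1))⁻¹ • (a (i + 1) : E) := fun i hi1 ↦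
    (hvert i (by omega)).2 (hQall (i + 1) hi1)
  /- ■ 8. concatenation -/
  obtain ⟨hDom, hpass⟩ := maximalGeodesic_of_matching_chain (cov := g.leviCivita) k' v
    (fun i ↦ (a i : E)) ℓ hℓpos (fun i hi ↦ (hseg i hi).1) (fun i hi ↦ (hseg i hi).2.1) hmatch
  have hℓ0 : 0 < ℓ 0 := hℓpos 0 hk'pos
  have hfut0 := (hseg 0 hk'pos).2.2.1
  refine ⟨v 0, by rw [hv0]; exact hp₀A, (ℓ 0)⁻¹ • (a 0 : TangentSpace I (v 0)), Stot, hStot_pos,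
    hDom, ?_, ?_, ?_, fun p hp ↦ ?_⟩
  · rw [map_smul, map_smul, smul_apply, smul_eq_mul, smul_eq_mul, ← mul_assoc,
      show g.val (v 0) (a 0) (a 0) = -(ℓ 0 ^ 2) by rw [hℓsq 0 hk'pos]; ring]
    field_simp
  · refine ⟨⟨?_, smul_ne_zero (inv_ne_zero hℓ0.ne') hfut0.1.2⟩, ?_⟩
    · rw [map_smul, map_smul, smul_apply, smul_eq_mul, smul_eq_mul, ← mul_assoc]
      nlinarith [mul_pos (inv_pos.2 hℓ0) (inv_pos.2 hℓ0), hQle 0 hk'pos]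
    · rw [map_smul, smul_eq_mul]
      exact mul_neg_of_pos_of_neg (inv_pos.2 hℓ0) hfut0.2
  · rw [← hvk']; exact hpass k' le_rfl
  · rw [hStot]; exact hdle p hp


end LorentzianMetric

end Literature.Geometry.Lorentzian

end
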